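import Summits.ResolutionOfSingularities.ResolutionOfSingularities.Theorems.FrobeniusLadderFInjectiveMacaulayficationProp44T1FullLineCentre
import Summits.ResolutionOfSingularities.ResolutionOfSingularities.Theorems.FrobeniusLadderFInjectiveMacaulayficationProp44T1FullPrimeCases
import Literature.AlgebraicGeometry.Resolution.ExcellentRings
import Literature.AlgebraicGeometry.Resolution.VPreparedLabelShear
import Literature.AlgebraicGeometry.Resolution.AxialUnitChainLaw
import HarnessLib

/-!
# Cossart–Piltant 2008, Prop. 4.4 — T1 FROM THE FULL-CHAIN RING CONTRACT v3′ (OPTION R; sorry-free oracle form)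

OURS (res-inputs-p-8b g2; critic R106 (Q3)). **GIVEN** (hypothesis `hN3`) the ring CONTRACT v3′ `false_of_fullChain_tau_one'` (signature
`candidates/F71_T1ring_CONTRACT_v3prime_SIGNATURE_p8b.lean` 4da8544dee9e0b4d; critic R112; ring side = res-inputs-p-7b's completed-chain descent + res-inputs-p-8a's
non-rational step), the chain of `τ = 1` near points of `stub_T1_false_of_nearChain_tau_one` (SIGNATURES v4 l.340, binders VERBATIM) is
IMPOSSIBLE: the chain is shifted to its first point step (T1-α p623079); the exceptional parameters `u_n` are chosen by recursion (`φ u_n` if it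
generates the exceptional ideal, else any generator — `IsBlowup.isEffectiveCartier`); every clause of the contract is discharged from tree theorems:
order/τ/G-ring bookkeeping, quasi-isolation (Stacks 01J7), the weak transform as a colon, the label-free point clause (σ′ p626364/p-6, `fullChain_hpt_cases`), the curve clause (κ p624926, any adapted presentation), `u_n ∈ P_n` (`fullChain_huP`), the next centre after a point step
(`fullChain_hPsucc_pt`, line centre p627545) and after a curve step (`fullChain_hPsucc_cv'`, κ″ p626243), infinitely many point steps (T1-α). Cossart–Piltant p. 11:
«we get a sequence of points `x_{σ(i)}` … `τ(x_{σ(i)}) = 1` for all `i ≥ 0` … a contradiction». AI-written; AI review weaker than expert review. `CossartPiltant2008_prop44`, T1 and the ring contract are NOT proved here;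
resolution in dimension `≥ 4` / positive characteristic is NOT proved. No definitions, no named facts.
-/

noncomputable section

open CategoryTheory CategoryTheory.Limits AlgebraicGeometry TopologicalSpace IsLocalRing MvPolynomial
open Literature.AlgebraicGeometry.Resolution Scheme.IdealSheafData

namespace Summit.ResolutionOfSingularities.ResolutionOfSingularities.Theorems

namespace CP2008Prop44

universe u

/-! ## T1 from the FULL-CHAIN contract (OPTION R): the scheme-side discharge -/

set_option maxHeartbeats 1600000 in
/-- **T1 FROM THE FULL-CHAIN RING CONTRACT, for a chain starting at a POINT step.** `hN3` = CONTRACT v3′ `false_of_fullChain_tau_one'` as a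
hypothesis; then the binders of `stub_T1_false_of_nearChain_tau_one` (SIGNATURES v4 l.340) VERBATIM; then `hpt0 : Y 0 = {x_0}` ⊢ `False`.
The exceptional parameters `u` are chosen by recursion (`u_{n+1} := φ u_n` if it generates the exceptional ideal, else any generator); the
trichotomy clauses come from σ′ (p-6) with the non-matching cases refuted by the label-free guards; the curve clauses from κ, the line centre
(both charts, through `isAdapted_comp_swap_of_isAdapted`) and κ″; `u_n ∈ P_n` because the generic point of a curve centre maps into the previous
centre. [cite: CossartPiltant2008, Prop. 4.4 (proof, p. 11), Lemma 4.5] [cite: CossartJannsenSaito2020, Thm. 13.7] -/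
theorem T1_of_N2full'_of_pt0
    (hN3 : ∀ (Rn : ℕ → Type u) [∀ n, CommRing (Rn n)] [∀ n, IsRegularLocalRing (Rn n)]
    (hdim : ∀ n, ringKrullDim (Rn n) = 3) (φ : ∀ n, Rn n →+* Rn (n + 1)) [∀ n, IsLocalHom (φ n)]
    (I : ∀ n, Ideal (Rn n)) {μ : ℕ} (hμ : 1 ≤ μ) (u : ∀ n, Rn n)
    (pt : ℕ → Prop) (hpt0 : pt 0)
    -- excellence at every level; level `0`: an adapted label `(c₀ 0, u 0, c₀ 2)` with `L < δs`
    (hG : ∀ n, IsGRing (Rn n))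
    (c₀ : Fin 3 → Rn 0) (hc₀ : Ideal.span {c₀ 0, c₀ 1, c₀ 2} = maximalIdeal (Rn 0)) (hc₀u : c₀ 1 = u 0)
    (hc₀ad : ∀ G ∈ initialForms c₀ (I 0) μ, ∃ a : ResidueField (Rn 0), G = C a * X 0 ^ μ)
    (hδ₀ : μ.factorial < deltaS c₀ (I 0) μ)
    -- every level: near, order exactly `μ`, `τ = 1` in every regular system of parameters
    (hIμ : ∀ n, I n ≤ maximalIdeal (Rn n) ^ μ) (hIne : ∀ n, ¬ I n ≤ maximalIdeal (Rn n) ^ (μ + 1))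
    (hτ : ∀ n (c : Fin 3 → Rn n), Ideal.span {c 0, c 1, c 2} = maximalIdeal (Rn n) →
      hironakaTauAt c (I n) μ = 1)
    -- the exceptional parameter (label-free) and the weak transform as the colon by its `μ`-th power
    (P : ∀ n, Ideal (Rn n))
    (hexc_pt : ∀ n, pt n → (maximalIdeal (Rn n)).map (φ n) = Ideal.span {u (n + 1)})
    (hexc_cv : ∀ n, ¬ pt n → (P n).map (φ n) = Ideal.span {u (n + 1)})
    (hI : ∀ n, I (n + 1) = ((I n).map (φ n)).colon {u (n + 1) ^ μ})
    -- POINT steps: for EVERY adapted label `c` (any orientation), the TRICHOTOMY of the near point in `c`'s own charts (σ/σ′):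
    -- (i)/(ii) rational point `(1 : ā)` of the `c 1`-chart · (iii) non-rational point of the `c 1`-chart · (i′) the origin of the `c 2`-chart
    (hpt_cases : ∀ n, pt n → ∀ (c : Fin 3 → Rn n), Ideal.span {c 0, c 1, c 2} = maximalIdeal (Rn n) →
      (∀ G ∈ initialForms c (I n) μ, ∃ a : ResidueField (Rn n), G = C a * X 0 ^ μ) →
      (Function.Surjective (ResidueField.map (φ n)) ∧
        ∃ (a : Rn n) (y' w' : Rn (n + 1)), φ n (c 0) = φ n (c 1) * y' ∧ φ n (c 2 - a * c 1) = φ n (c 1) * w' ∧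
          Ideal.span {y', φ n (c 1), w'} = maximalIdeal (Rn (n + 1))) ∨
      (¬ Function.Surjective (ResidueField.map (φ n)) ∧
        ∃ (t : Rn (n + 1)) (Q : Polynomial (Rn n)) (y' : Rn (n + 1)),
          φ n (c 0) = φ n (c 1) * y' ∧ φ n (c 2) = φ n (c 1) * t ∧ Q.Monic ∧
          2 ≤ (Q.map (residue (Rn n))).natDegree ∧ Irreducible (Q.map (residue (Rn n))) ∧
          (∀ G : Polynomial (Rn n), Polynomial.eval₂ (φ n) t G ∈ maximalIdeal (Rn (n + 1)) ↔
            Q.map (residue (Rn n)) ∣ G.map (residue (Rn n))) ∧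
          (∀ r : ResidueField (Rn (n + 1)), ∃ G : Polynomial (Rn n), residue (Rn (n + 1)) (Polynomial.eval₂ (φ n) t G) = r) ∧
          Ideal.span {y', φ n (c 1), Polynomial.eval₂ (φ n) t Q} = maximalIdeal (Rn (n + 1))) ∨
      (Function.Surjective (ResidueField.map (φ n)) ∧
        ∃ (y' v' : Rn (n + 1)), φ n (c 0) = φ n (c 2) * y' ∧ φ n (c 1) = φ n (c 2) * v' ∧
          Ideal.span {y', v', φ n (c 2)} = maximalIdeal (Rn (n + 1))))
    -- CURVE steps: centre prime `P n ∋ u n`, permissibility, chart for EVERY adapted presentation `(y, v)`, `v` ~ `u_n`, of the centre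
    (hIP : ∀ n, ¬ pt n → I n ≤ P n ^ μ) (huP : ∀ n, ¬ pt n → u n ∈ P n)
    (hcurve : ∀ n, ¬ pt n → ∀ (y v w : Rn n), Ideal.span {v} = Ideal.span {u n} → Ideal.span {y, v} = P n →
      Ideal.span {y, v, w} = maximalIdeal (Rn n) →
      (∀ G ∈ initialForms ![y, v, w] (I n) μ, ∃ a : ResidueField (Rn n), G = C a * X 0 ^ μ) →
      Function.Surjective (ResidueField.map (φ n)) ∧
      ∃ y' : Rn (n + 1), φ n y = φ n v * y' ∧
        Ideal.span {y', φ n v, φ n w} = maximalIdeal (Rn (n + 1)))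
    -- quasi-isolation at EVERY level, relative to the centre (point steps: `pt n ∨ …`)
    (hqis : ∀ n (𝔮 : Ideal (Rn n)) [𝔮.IsPrime], 𝔮 ≠ maximalIdeal (Rn n) → (pt n ∨ 𝔮 ≠ P n) →
      ¬ (I n).map (algebraMap (Rn n) (Localization.AtPrime 𝔮)) ≤ maximalIdeal (Localization.AtPrime 𝔮) ^ μ)
    -- after a POINT step the next centre (if a curve) is the line `(y′, u_{n+1})`, in whichever chart `x_{n+1}` lies
    (hPsucc_pt : ∀ n, pt n → ¬ pt (n + 1) → ∀ (y w : Rn n) (y' : Rn (n + 1)),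
      Ideal.span {y, u n, w} = maximalIdeal (Rn n) →
      (∀ G ∈ initialForms ![y, u n, w] (I n) μ, ∃ a : ResidueField (Rn n), G = C a * X 0 ^ μ) →
      φ n y = u (n + 1) * y' → Ideal.span {y', u (n + 1)} = P (n + 1))
    -- after a CURVE step the next centre (if a curve) is the strict transform up to a correction `β ∈ 𝔪_n` (κ″)
    (hPsucc_cv : ∀ n, ¬ pt n → ¬ pt (n + 1) → ∀ (y v w : Rn n) (y' : Rn (n + 1)), Ideal.span {v} = Ideal.span {u n} →
      Ideal.span {y, v} = P n → Ideal.span {y, v, w} = maximalIdeal (Rn n) →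
      (∀ G ∈ initialForms ![y, v, w] (I n) μ, ∃ a : ResidueField (Rn n), G = C a * X 0 ^ μ) →
      φ n y = φ n v * y' →
      u (n + 1) ∈ P (n + 1) ∧ ∃ β ∈ maximalIdeal (Rn n), Ideal.span {y' + φ n β, u (n + 1)} = P (n + 1))
    -- infinitely many point steps (T1-α)
    (hinf : ∀ n₀, ∃ n, n₀ ≤ n ∧ pt n),
      False)
    (Xs : ℕ → Scheme.{u})
    (hN : ∀ n, IsLocallyNoetherian (Xs n)) (hXreg : ∀ n, Scheme.IsRegular (Xs n))
    (π : ∀ n, Xs (n + 1) ⟶ Xs n) (Y : ∀ n, Closeds (Xs n)) (y : ∀ n, Xs (n + 1))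
    (J : ∀ n, (Xs n).IdealSheafData) {μ : ℕ} (hμ : 1 ≤ μ)
    (hy : ∀ n, π (n + 1) (y (n + 1)) = y n)
    (hmem : ∀ n, π n (y n) ∈ (Y n : Set (Xs n)))
    (hcl : ∀ n, IsClosed ({π n (y n)} : Set (Xs n)))
    (hYirr : ∀ n, IsIrreducible ((Y n : Closeds (Xs n)) : Set (Xs n)))
    (hYreg : ∀ n, Scheme.IsRegular (vanishingIdeal (Y n)).subscheme)
    (hYord : ∀ n, ∀ z ∈ (Y n : Set (Xs n)), idealOrder (J n) z = μ)
    (hπ : ∀ n, IsBlowup (π n) (vanishingIdeal (Y n)))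
    (hJ : ∀ n, J (n + 1) = controlledTransform (π n) (vanishingIdeal (Y n)) (J n) μ)
    (hbd : ∀ n (z : Xs n), idealOrder (J n) z ≤ μ)
    (hcodim : ∀ n, ∀ z ∈ (J n).support, 1 < Order.coheight z)
    (hd : ∀ n, (maximalIdeal ((Xs n).presheaf.stalk (π n (y n)))).spanFinrank = 3)
    (hnear : ∀ n, IsNear (π n) (vanishingIdeal (Y n)) (J n) μ (y n))
    (hτ : ∀ n, @stalkTau (Xs n) (J n) (π n (y n)) (hXreg n (π n (y n))) μ = 1)
    (hG : ∀ n, IsGRing ((Xs n).presheaf.stalk (π n (y n))))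
    (hcoinc : ∀ n (z : Xs n), z ⤳ π n (y n) → idealOrder (J n) z = μ → z ∈ (Y n : Set (Xs n)))
    (hpt0 : (Y 0 : Set (Xs 0)) = {π 0 (y 0)}) :
    False := by
  classical
  haveI := hN
  haveI hR : ∀ n, IsRegularLocalRing (chainRing Xs π y n) := fun n => hXreg n _
  haveI hDom : ∀ n, IsDomain (chainRing Xs π y n) := fun n => isDomain_of_isRegularLocalRing _
  have rangeFin3 : ∀ {α : Type u} (c : Fin 3 → α), Set.range c = {c 0, c 1, c 2} := by
    intro α c
    ext a
    simp only [Set.mem_range, Set.mem_insert_iff, Set.mem_singleton_iff]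
    constructor
    · rintro ⟨i, rfl⟩
      fin_cases i
      · exact Or.inl rfl
      · exact Or.inr (Or.inl rfl)
      · exact Or.inr (Or.inr rfl)
    · rintro (h | h | h) <;> exact ⟨_, h.symm⟩
  have range3 : ∀ {α : Type u} (a b c : α), Set.range ![a, b, c] = {a, b, c} := by
    intro α a b c
    rw [rangeFin3]; rfl
  have hordx : ∀ n, idealOrder (J n) (π n (y n)) = μ := fun n => hYord n _ (hmem n)
  have hIμ : ∀ n, chainIdeal Xs π y J n ≤ maximalIdeal _ ^ μ := fun n =>
    (le_idealOrder_iff (J n) (π n (y n)) μ).mp (hordx n).ge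
  have hIne : ∀ n, ¬ chainIdeal Xs π y J n ≤ maximalIdeal _ ^ (μ + 1) := by
    intro n h
    have h' := (le_idealOrder_iff (J n) (π n (y n)) (μ + 1)).mpr h
    rw [hordx n] at h'
    exact absurd (by exact_mod_cast h' : μ + 1 ≤ μ) (by omega)
  have hdim : ∀ n, ringKrullDim (chainRing Xs π y n) = 3 := by
    intro n
    have h := (isRegularLocalRing_iff (chainRing Xs π y n)).mp inferInstance
    rw [hd n] at h
    exact_mod_cast h.symm
  have hτr : ∀ n (c : Fin 3 → chainRing Xs π y n), Ideal.span (Set.range c) = maximalIdeal _ →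
      hironakaTauAt c (chainIdeal Xs π y J n) μ = 1 := by
    intro n c hc
    rw [chainIdeal, ← stalkTau_eq (J n) (π n (y n)) μ (hd n) c hc]
    exact hτ n
  have hτ3 : ∀ n (c : Fin 3 → chainRing Xs π y n), Ideal.span {c 0, c 1, c 2} = maximalIdeal _ →
      hironakaTauAt c (chainIdeal Xs π y J n) μ = 1 := fun n c hc => hτr n c (by rw [rangeFin3]; exact hc)
  have hIP : ∀ n, chainIdeal Xs π y J n ≤ stalkIdeal (vanishingIdeal (Y n)) (π n (y n)) ^ μ := by
    intro n
    rw [chainIdeal, ← stalkIdeal_pow]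
    exact stalkIdeal_mono (le_vanishingIdeal_pow_of_forall_idealOrder_eq (hXreg n) (hYreg n) (hYord n)) _
  have hpt_P : ∀ n, (Y n : Set (Xs n)) = {π n (y n)} → stalkIdeal (vanishingIdeal (Y n)) (π n (y n)) = maximalIdeal _ := by
    intro n hn
    have hYn : Y n = ⟨{π n (y n)}, hcl n⟩ := Closeds.ext hn
    rw [hYn, stalkIdeal_vanishingIdeal_singleton (hcl n)]
  have hqis := fullChain_hqis Xs hN hXreg π Y y J hμ hy hmem hcl hYirr hYreg hYord hπ hJ hbd hcodim hd hnear hτ hG hcoinc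
  have hisol_pt : ∀ n, (Y n : Set (Xs n)) = {π n (y n)} → ∀ (𝔮 : Ideal (chainRing Xs π y n)) [𝔮.IsPrime], 𝔮 ≠ maximalIdeal _ →
      ¬ (chainIdeal Xs π y J n).map (algebraMap _ (Localization.AtPrime 𝔮)) ≤ maximalIdeal (Localization.AtPrime 𝔮) ^ μ :=
    fun n hn 𝔮 _ h𝔮 => hqis n 𝔮 h𝔮 (by rw [hpt_P n hn]; exact h𝔮)
  have hcM : ∀ n, chainMap Xs π y hy n = stalkMapCongr (π n) (y n) (π (n + 1) (y (n + 1))) (hy n) := fun n => rfl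
  have hexE : ∀ n, ∃ g : chainRing Xs π y (n + 1),
      (stalkIdeal (vanishingIdeal (Y n)) (π n (y n))).map (chainMap Xs π y hy n) = Ideal.span {g} :=
    fun n => exists_map_stalkIdeal_centre_eq_span_congr (hπ n) (π (n + 1) (y (n + 1))) (hy n)
  obtain ⟨c₀, hc₀r, hc₀ad⟩ :=
    exists_rsop_forall_ne_zero_isAdapted_of_stalkTau_eq_one (J 0) (π 0 (y 0)) (hd 0) (hτ 0)
  let uStep : ∀ n, chainRing Xs π y n → chainRing Xs π y (n + 1) := fun n v =>
    if Ideal.span {chainMap Xs π y hy n v} = Ideal.span {Classical.choose (hexE n)} then chainMap Xs π y hy n v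
    else Classical.choose (hexE n)
  let u : ∀ n, chainRing Xs π y n := fun n => Nat.rec (motive := fun n => chainRing Xs π y n) (c₀ 1) (fun n v => uStep n v) n
  have hu0 : u 0 = c₀ 1 := rfl
  have husucc : ∀ n, u (n + 1) = uStep n (u n) := fun n => rfl
  have hE : ∀ n, (stalkIdeal (vanishingIdeal (Y n)) (π n (y n))).map (chainMap Xs π y hy n) = Ideal.span {u (n + 1)} := by
    intro n
    rw [husucc]
    by_cases hc : Ideal.span {chainMap Xs π y hy n (u n)} = Ideal.span {Classical.choose (hexE n)}
    · simp only [uStep, hc, if_true]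
      exact Classical.choose_spec (hexE n)
    · simp only [uStep, hc, if_false]
      exact Classical.choose_spec (hexE n)
  have hu_rat : ∀ n, Ideal.span {chainMap Xs π y hy n (u n)} = Ideal.span {u (n + 1)} → u (n + 1) = chainMap Xs π y hy n (u n) := by
    intro n h
    rw [husucc] at h ⊢
    by_cases hc : Ideal.span {chainMap Xs π y hy n (u n)} = Ideal.span {Classical.choose (hexE n)}
    · simp only [uStep, hc, if_true]
    · simp only [uStep, hc, if_false] at h
  -- THE CONTRACT
  refine hN3 (fun n => chainRing Xs π y n) hdim (fun n => chainMap Xs π y hy n) (fun n => chainIdeal Xs π y J n) hμ u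
    (fun n => (Y n : Set (Xs n)) = {π n (y n)}) hpt0 hG c₀ ?_ hu0.symm ?_ ?_ hIμ hIne hτ3
    (fun n => stalkIdeal (vanishingIdeal (Y n)) (π n (y n))) ?_ ?_ ?_ ?_ (fun n _ => hIP n) (fun n hn => ?_) ?_ ?_ ?_ ?_ ?_
  · -- hc₀
    rw [← rangeFin3]; exact hc₀r
  · -- hc₀ad
    exact forall_initialForms_eq_C_mul_X_pow_of_isAdapted c₀ (hτr 0 c₀ hc₀r) hc₀ad
  · -- hδ₀
    have hc₀3 : Ideal.span {c₀ 0, c₀ 1, c₀ 2} = maximalIdeal _ := by rw [← rangeFin3]; exact hc₀r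
    have hne := (pts_nonempty_and_alphaS_lt_of_isolated c₀ hc₀3 (hdim 0) (hisol_pt 0 hpt0)).1
    exact factorial_lt_deltaS_of_isAdapted c₀ hc₀3 (hdim 0) (hIμ 0) hne (hτr 0 c₀ hc₀r) hc₀ad
  · -- hexc_pt
    intro n hn; rw [← hpt_P n hn]; exact hE n
  · -- hexc_cv
    intro n _; exact hE n
  · -- hI
    intro n
    change stalkIdeal (J (n + 1)) (π (n + 1) (y (n + 1))) = _
    rw [hJ n]
    exact stalkIdeal_controlledTransform_eq_colon_of_map_eq_span_congr (Y n) (J n) μ _ (hy n) (u (n + 1)) (hE n)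
  · -- hpt_cases
    intro n hptn c hc3 had
    exact fullChain_hpt_cases Xs hN hXreg π Y y J hμ hy hmem hcl hYirr hYreg hYord hπ hJ hbd hcodim hd hnear hτ hG hcoinc n hptn c hc3 had
  · -- huP
    cases n with
    | zero => exact absurd hpt0 hn
    | succ k => exact fullChain_huP Xs hN hXreg π Y y J hμ hy hmem hcl hYirr hYreg hYord hπ hJ hbd hcodim hd hnear hτ hG hcoinc k hn (u (k + 1)) (hE k)
  · -- hcurve
    intro n hnpt yv v wv _hv hyu hgen had
    show Function.Surjective (ResidueField.map (chainMap Xs π y hy n)) ∧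
      ∃ y' : chainRing Xs π y (n + 1), chainMap Xs π y hy n yv = chainMap Xs π y hy n v * y' ∧
        Ideal.span {y', chainMap Xs π y hy n v, chainMap Xs π y hy n wv} = maximalIdeal (chainRing Xs π y (n + 1))
    set c : Fin 3 → chainRing Xs π y n := ![yv, v, wv] with hc_def
    have hc : Ideal.span (Set.range c) = maximalIdeal _ := by rw [hc_def, range3]; exact hgen
    have hcY : Ideal.span {c 0, c 1} = stalkIdeal (vanishingIdeal (Y n)) (π n (y n)) := by
      simp only [hc_def, Matrix.cons_val_zero, Matrix.cons_val_one]; exact hyu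
    have hadI : ∀ i, i ≠ 0 → IsAdapted c (chainIdeal Xs π y J n) μ i := bridge_isAdapted had
    obtain ⟨c', -, h1, h0, h2, hgen', hsurj, -⟩ :=
      IsBlowup.exists_curveStepData_of_adapted_congr (hXreg n) (hYreg n) (hπ n) hμ (hYord n) (hd n)
        hc hcY (hτ n) hadI (hnear n) (π (n + 1) (y (n + 1))) (hy n)
    refine ⟨hsurj, c' 0, ?_, ?_⟩
    · rw [hcM]; simpa [hc_def] using h0
    · rw [h1, h2] at hgen'
      rw [hcM]
      simp only [hc_def, Matrix.cons_val_one, Matrix.cons_val_zero, Matrix.cons_val_two, Matrix.tail_cons, Matrix.head_cons] at hgen'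
      convert hgen' using 2
  · -- hqis
    intro n 𝔮 _ h𝔮 hor
    refine hqis n 𝔮 h𝔮 ?_
    rcases hor with hptn | hne
    · rw [hpt_P _ hptn]; exact h𝔮
    · exact hne
  · -- hPsucc_pt
    intro n hptn hnpt1 yv wv y' hgen had hrel
    have hEm : (maximalIdeal (chainRing Xs π y n)).map (chainMap Xs π y hy n) = Ideal.span {u (n + 1)} := by
      rw [← hpt_P n hptn]; exact hE n
    exact fullChain_hPsucc_pt Xs hN hXreg π Y y J hμ hy hmem hcl hYirr hYreg hYord hπ hJ hbd hcodim hd hnear hτ hG hcoinc n hptn (u n) (u (n + 1)) hEm (hu_rat n) yv wv hgen had hnpt1 y' hrel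
  · -- hPsucc_cv
    intro n hnpt hnpt1 yv v wv y' _hv hyu hgen had hrel
    exact fullChain_hPsucc_cv' Xs hN hXreg π Y y J hμ hy hmem hcl hYirr hYreg hYord hπ hJ hbd hcodim hd hnear hτ hG hcoinc n hnpt hnpt1 v (u (n + 1)) (hE n) yv wv y' hyu hgen had hrel
  · -- hinf
    exact tauOneChain_exists_pointStep_ge Xs hN hXreg π Y y J hμ hy hmem hcl hYirr hYreg hYord hπ hJ hcodim hd hcoinc


/-- **T1 FROM THE FULL-CHAIN RING CONTRACT (OPTION R, critic R106).** `hN3` = CONTRACT v3′ `false_of_fullChain_tau_one'` (res-inputs-p-8b signature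
4da8544dee9e0b4d; ring side: res-inputs-p-7b/p-8a) as a hypothesis; then the binders of `stub_T1_false_of_nearChain_tau_one` (SIGNATURES v4 l.340)
VERBATIM ⊢ `False`: shift the chain to its first POINT step (T1-α `tauOneChain_exists_pointStep_ge`) and apply `T1_of_N2full'_of_pt0`.
[cite: CossartPiltant2008, Prop. 4.4 (proof, p. 11), Lemma 4.5] [cite: CossartJannsenSaito2020, Thm. 13.7] -/
theorem T1_of_N2full'
    (hN3 : ∀ (Rn : ℕ → Type u) [∀ n, CommRing (Rn n)] [∀ n, IsRegularLocalRing (Rn n)]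
    (hdim : ∀ n, ringKrullDim (Rn n) = 3) (φ : ∀ n, Rn n →+* Rn (n + 1)) [∀ n, IsLocalHom (φ n)]
    (I : ∀ n, Ideal (Rn n)) {μ : ℕ} (hμ : 1 ≤ μ) (u : ∀ n, Rn n)
    (pt : ℕ → Prop) (hpt0 : pt 0)
    -- excellence at every level; level `0`: an adapted label `(c₀ 0, u 0, c₀ 2)` with `L < δs`
    (hG : ∀ n, IsGRing (Rn n))
    (c₀ : Fin 3 → Rn 0) (hc₀ : Ideal.span {c₀ 0, c₀ 1, c₀ 2} = maximalIdeal (Rn 0)) (hc₀u : c₀ 1 = u 0)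
    (hc₀ad : ∀ G ∈ initialForms c₀ (I 0) μ, ∃ a : ResidueField (Rn 0), G = C a * X 0 ^ μ)
    (hδ₀ : μ.factorial < deltaS c₀ (I 0) μ)
    -- every level: near, order exactly `μ`, `τ = 1` in every regular system of parameters
    (hIμ : ∀ n, I n ≤ maximalIdeal (Rn n) ^ μ) (hIne : ∀ n, ¬ I n ≤ maximalIdeal (Rn n) ^ (μ + 1))
    (hτ : ∀ n (c : Fin 3 → Rn n), Ideal.span {c 0, c 1, c 2} = maximalIdeal (Rn n) →
      hironakaTauAt c (I n) μ = 1)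
    -- the exceptional parameter (label-free) and the weak transform as the colon by its `μ`-th power
    (P : ∀ n, Ideal (Rn n))
    (hexc_pt : ∀ n, pt n → (maximalIdeal (Rn n)).map (φ n) = Ideal.span {u (n + 1)})
    (hexc_cv : ∀ n, ¬ pt n → (P n).map (φ n) = Ideal.span {u (n + 1)})
    (hI : ∀ n, I (n + 1) = ((I n).map (φ n)).colon {u (n + 1) ^ μ})
    -- POINT steps: for EVERY adapted label `c` (any orientation), the TRICHOTOMY of the near point in `c`'s own charts (σ/σ′):
    -- (i)/(ii) rational point `(1 : ā)` of the `c 1`-chart · (iii) non-rational point of the `c 1`-chart · (i′) the origin of the `c 2`-chart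
    (hpt_cases : ∀ n, pt n → ∀ (c : Fin 3 → Rn n), Ideal.span {c 0, c 1, c 2} = maximalIdeal (Rn n) →
      (∀ G ∈ initialForms c (I n) μ, ∃ a : ResidueField (Rn n), G = C a * X 0 ^ μ) →
      (Function.Surjective (ResidueField.map (φ n)) ∧
        ∃ (a : Rn n) (y' w' : Rn (n + 1)), φ n (c 0) = φ n (c 1) * y' ∧ φ n (c 2 - a * c 1) = φ n (c 1) * w' ∧
          Ideal.span {y', φ n (c 1), w'} = maximalIdeal (Rn (n + 1))) ∨
      (¬ Function.Surjective (ResidueField.map (φ n)) ∧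
        ∃ (t : Rn (n + 1)) (Q : Polynomial (Rn n)) (y' : Rn (n + 1)),
          φ n (c 0) = φ n (c 1) * y' ∧ φ n (c 2) = φ n (c 1) * t ∧ Q.Monic ∧
          2 ≤ (Q.map (residue (Rn n))).natDegree ∧ Irreducible (Q.map (residue (Rn n))) ∧
          (∀ G : Polynomial (Rn n), Polynomial.eval₂ (φ n) t G ∈ maximalIdeal (Rn (n + 1)) ↔
            Q.map (residue (Rn n)) ∣ G.map (residue (Rn n))) ∧
          (∀ r : ResidueField (Rn (n + 1)), ∃ G : Polynomial (Rn n), residue (Rn (n + 1)) (Polynomial.eval₂ (φ n) t G) = r) ∧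
          Ideal.span {y', φ n (c 1), Polynomial.eval₂ (φ n) t Q} = maximalIdeal (Rn (n + 1))) ∨
      (Function.Surjective (ResidueField.map (φ n)) ∧
        ∃ (y' v' : Rn (n + 1)), φ n (c 0) = φ n (c 2) * y' ∧ φ n (c 1) = φ n (c 2) * v' ∧
          Ideal.span {y', v', φ n (c 2)} = maximalIdeal (Rn (n + 1))))
    -- CURVE steps: centre prime `P n ∋ u n`, permissibility, chart for EVERY adapted presentation `(y, v)`, `v` ~ `u_n`, of the centre
    (hIP : ∀ n, ¬ pt n → I n ≤ P n ^ μ) (huP : ∀ n, ¬ pt n → u n ∈ P n)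
    (hcurve : ∀ n, ¬ pt n → ∀ (y v w : Rn n), Ideal.span {v} = Ideal.span {u n} → Ideal.span {y, v} = P n →
      Ideal.span {y, v, w} = maximalIdeal (Rn n) →
      (∀ G ∈ initialForms ![y, v, w] (I n) μ, ∃ a : ResidueField (Rn n), G = C a * X 0 ^ μ) →
      Function.Surjective (ResidueField.map (φ n)) ∧
      ∃ y' : Rn (n + 1), φ n y = φ n v * y' ∧
        Ideal.span {y', φ n v, φ n w} = maximalIdeal (Rn (n + 1)))
    -- quasi-isolation at EVERY level, relative to the centre (point steps: `pt n ∨ …`)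
    (hqis : ∀ n (𝔮 : Ideal (Rn n)) [𝔮.IsPrime], 𝔮 ≠ maximalIdeal (Rn n) → (pt n ∨ 𝔮 ≠ P n) →
      ¬ (I n).map (algebraMap (Rn n) (Localization.AtPrime 𝔮)) ≤ maximalIdeal (Localization.AtPrime 𝔮) ^ μ)
    -- after a POINT step the next centre (if a curve) is the line `(y′, u_{n+1})`, in whichever chart `x_{n+1}` lies
    (hPsucc_pt : ∀ n, pt n → ¬ pt (n + 1) → ∀ (y w : Rn n) (y' : Rn (n + 1)),
      Ideal.span {y, u n, w} = maximalIdeal (Rn n) →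
      (∀ G ∈ initialForms ![y, u n, w] (I n) μ, ∃ a : ResidueField (Rn n), G = C a * X 0 ^ μ) →
      φ n y = u (n + 1) * y' → Ideal.span {y', u (n + 1)} = P (n + 1))
    -- after a CURVE step the next centre (if a curve) is the strict transform up to a correction `β ∈ 𝔪_n` (κ″)
    (hPsucc_cv : ∀ n, ¬ pt n → ¬ pt (n + 1) → ∀ (y v w : Rn n) (y' : Rn (n + 1)), Ideal.span {v} = Ideal.span {u n} →
      Ideal.span {y, v} = P n → Ideal.span {y, v, w} = maximalIdeal (Rn n) →
      (∀ G ∈ initialForms ![y, v, w] (I n) μ, ∃ a : ResidueField (Rn n), G = C a * X 0 ^ μ) →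
      φ n y = φ n v * y' →
      u (n + 1) ∈ P (n + 1) ∧ ∃ β ∈ maximalIdeal (Rn n), Ideal.span {y' + φ n β, u (n + 1)} = P (n + 1))
    -- infinitely many point steps (T1-α)
    (hinf : ∀ n₀, ∃ n, n₀ ≤ n ∧ pt n),
      False)
    (Xs : ℕ → Scheme.{u})
    (hN : ∀ n, IsLocallyNoetherian (Xs n)) (hXreg : ∀ n, Scheme.IsRegular (Xs n))
    (π : ∀ n, Xs (n + 1) ⟶ Xs n) (Y : ∀ n, Closeds (Xs n)) (y : ∀ n, Xs (n + 1))
    (J : ∀ n, (Xs n).IdealSheafData) {μ : ℕ} (hμ : 1 ≤ μ)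
    (hy : ∀ n, π (n + 1) (y (n + 1)) = y n)
    (hmem : ∀ n, π n (y n) ∈ (Y n : Set (Xs n)))
    (hcl : ∀ n, IsClosed ({π n (y n)} : Set (Xs n)))
    (hYirr : ∀ n, IsIrreducible ((Y n : Closeds (Xs n)) : Set (Xs n)))
    (hYreg : ∀ n, Scheme.IsRegular (vanishingIdeal (Y n)).subscheme)
    (hYord : ∀ n, ∀ z ∈ (Y n : Set (Xs n)), idealOrder (J n) z = μ)
    (hπ : ∀ n, IsBlowup (π n) (vanishingIdeal (Y n)))
    (hJ : ∀ n, J (n + 1) = controlledTransform (π n) (vanishingIdeal (Y n)) (J n) μ)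
    (hbd : ∀ n (z : Xs n), idealOrder (J n) z ≤ μ)
    (hcodim : ∀ n, ∀ z ∈ (J n).support, 1 < Order.coheight z)
    (hd : ∀ n, (maximalIdeal ((Xs n).presheaf.stalk (π n (y n)))).spanFinrank = 3)
    (hnear : ∀ n, IsNear (π n) (vanishingIdeal (Y n)) (J n) μ (y n))
    (hτ : ∀ n, @stalkTau (Xs n) (J n) (π n (y n)) (hXreg n (π n (y n))) μ = 1)
    (hG : ∀ n, IsGRing ((Xs n).presheaf.stalk (π n (y n))))
    (hcoinc : ∀ n (z : Xs n), z ⤳ π n (y n) → idealOrder (J n) z = μ → z ∈ (Y n : Set (Xs n))) :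
    False := by
  obtain ⟨n₁, -, hpt₁⟩ :=
    tauOneChain_exists_pointStep_ge Xs hN hXreg π Y y J hμ hy hmem hcl hYirr hYreg hYord hπ hJ hcodim hd hcoinc 0
  exact T1_of_N2full'_of_pt0 hN3 (fun k => Xs (n₁ + k)) (fun k => hN (n₁ + k)) (fun k => hXreg (n₁ + k)) (fun k => π (n₁ + k))
    (fun k => Y (n₁ + k)) (fun k => y (n₁ + k)) (fun k => J (n₁ + k)) hμ (fun k => hy (n₁ + k)) (fun k => hmem (n₁ + k))
    (fun k => hcl (n₁ + k)) (fun k => hYirr (n₁ + k)) (fun k => hYreg (n₁ + k)) (fun k => hYord (n₁ + k)) (fun k => hπ (n₁ + k))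
    (fun k => hJ (n₁ + k)) (fun k => hbd (n₁ + k)) (fun k => hcodim (n₁ + k)) (fun k => hd (n₁ + k)) (fun k => hnear (n₁ + k))
    (fun k => hτ (n₁ + k)) (fun k => hG (n₁ + k)) (fun k => hcoinc (n₁ + k)) hpt₁

end CP2008Prop44

end Summit.ResolutionOfSingularities.ResolutionOfSingularities.Theorems

end
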